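/- Copyright: the b2b-balaban cell (near-miss cell 7), T⁴-continuum fan-out, lineage t4-ne7b-p1 (node U5c COUNT
member).  Released under the licence of the surrounding project. -/
import Summits.QuantumFields.BalabanUV.T4Continuum.Support.HistoryBankingAnchors
import Summits.QuantumFields.BalabanUV.T4Continuum.Support.HistoryBankingFattenedVolume

/-!
# M5-2e (E2) — THE PER-LEVEL DEAD BOX: from the 14th step after condition (i) a dead orbit lies in the radius-`82`
box about its anchor, and the `82`-thickening of a lag-time footprint costs `collar82 d + feed82 d·#Z∕2^i` cubes
(owner module of row NE7b, lineage `t4-ne7b-p1` gen 51; re-open object (α), ruling R-OWNER-51-1 «THE CENSUS READING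
AFTER VOLUME-3; M5-2e COMMISSIONED», `SPEC-M5-2e-PER-LEVEL-BOX.v0.md` §2; PRE-POSITIONING ONLY)

Summits-side support leaf of the T⁴-continuum cell (rung (B)+1 on a FINITE torus only; NOT infinite volume, NOT the
mass gap, NOT the Clay statement; NOT a proof of the spine estimate NE7b — the cell's OWN estimate, NOT PRINTED, NOT
PROVED).  [folklore] finite combinatorics on `ℤᵈ` and real arithmetic over the b02 lineage's index model of the
operation `S` (`B16SProfile`: `Sop`, `Siter`, `ratio`, `DropCtl`, `box`; `B16Absorption`: `pbox`, `width`, `shrink`,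
`env`, `envLo`; `B13ScaleTransfer.coarse` ∕ `closureIdx`), REUSING BY NAME b02's `B16Overhang.side_le_83` (from the
`14`th step after condition (i) the orbit box has side `≤ 83`: `shrink ≤ 1` once `gains ≥ 7`),
`B16MergeHorizon.near_of_condI_touch` ∕ `altGain_ratio` ∕ `dropCtl_shift`, `B16Absorption.Siter_subset_pbox_of_near` ∕
`env_sub_envLo_le_width`, `B16OverhangN.closureIdx_Qprod_subset_Siter` ∕ `touchConnected_closureIdx`, the lineage's A1
`HistoryBankingAnchors.card_closureIdx_Qfrom_le_card` (footprint decay) and M5-1b (G1)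
`HistoryBankingFattenedVolume.card_biUnion_box_le_of_touchConnected_real` (the union lemma over a touch-connected set
of box centres); nothing printed is asserted, no `def … : Prop` fact of Bałaban's is minted, no cite-tagged hypothesis,
zero `sorry`.  Two `def`s (`collar82`, `feed82`) are explicit real constants of OUR bookkeeping; they introduce no notion
of Bałaban's.  B16 = [Balaban1989LargeFieldII] pp. 384–387 under audit; locators only.

WHY (ruling R-OWNER-51-1, journal «RULING R-OWNER-51-1»; refuter PRICING-NE7b v19 F99 (5)–(6) lever (g1′); balaban-calc
GRAMMAR v75 G39 «VOLUME-3»).  After M5-2d (`HistoryBankingShrunkLedger`) the floor exchange of the volume ledger is the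
lag-free constant `6·1122^d` = 2 × 3 × (`561^d` cubes of A1's radius-`280` dead-orbit box `orbit_subset_box_of_condI`)
× (`2^d` anchors of a coalesced footprint); under the census reading of record (A) this leaves the lattice volume-prefix
threshold at `5.67·10⁵·ρ`, vacuous at ratio one by 3.1 orders (G39).  The radius `280 = width (≤ 80) + 2·shrink (≤ 100)`
is b02's ALL-STEPS orbit box (`side_le_281`); b02 ALSO proves the finer regime `side_le_83`: from the `14`th step after
condition (i) `shrink ≤ 1`, so the whole orbit — which contains the anchor's coarse image — lies in one pbox of side
`≤ 83`, i.e. in the radius-`82` box ABOUT THE SAME ANCHOR (no drift term; A1's anchor frame and transport unchanged —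
the refuter's Q-v19-1 (b)).  THIS FILE supplies that geometry: §1 the b02-level statement `Siter_subset_box82_of_condI`
(b02's Part 2 proof with `side_le_281 ↦ side_le_83`); §2 the orbit vocabulary (`orbit_subset_box82_of_condI`,
`card_orbit_le_165_of_condI`); §3 the THICKENED FOOTPRINT COUNT: for a non-empty touch-connected reference `Z` at time
`t` and `i ≥ 1`, the `r`-thickening of the footprint `closureIdx (Qfrom L s t i) Z` (touch-connected — b02 — with
`≤ 2^d·(16·21^d·#Z∕2^i + 1)` cubes — A1) has at most `(2r+1)^d + (2^d − 1)·d·(2r+1)^{d−1} + 2^d·16·21^d·d·(2r+1)^{d−1}·#Z∕2^i`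
cubes (the union lemma: one full box, one face slab per further centre), at `r = 82`: `collar82 d + feed82 d·#Z∕2^i`
with **`collar82 d = 165^d + (2^d − 1)·d·165^{d−1}`** (d = 4: `1 010 728 125`) and **`feed82 d = 2^d·16·21^d·d·165^{d−1}`**;
§4 numerals at `d = 4`.

WHAT IS *NOT* DONE HERE.  The three-way split of the births along a pedigree and the per-step inequality (E3
`HistoryBankingPedigreeLedger82`), the summed ledger with the fresh-dead exchange (E4 `HistoryBankingShrunkLedger82`),
the witness plug (E5).  HONEST: index-model bookkeeping one b02 lemma deeper; the census consequence (floor display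
`u_t·6·collar82 d ≤ floorK`, `6·collar82 4∕64⁴ = 361.46` ⇒ NIL iff `ρ ≤ 1.21 … 1.56` under reading (A)) is the OWNER's
ruling and balaban-calc's to certify («VOLUME-4»), not a kernel fact; NE7b NOT proved; spine 0∕9.  HONEST DEPENDENCY
(cell): continuum YM on T⁴ ⇐ BetaPertH ∧ nine spine estimates (0∕9 proved); BetaPertH ⇐ (D1) ∧ (D4) ∧ CAP+tail; G-an2-4 gates asym, D1 and NE2∕3∕4.
This file changes none of it.
-/

open Finset
open Literature.MathematicalPhysics.QuantumFieldTheory.Balaban1983to89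
open Literature.MathematicalPhysics.QuantumFieldTheory.Balaban1983to89.B13ScaleTransfer
open Literature.MathematicalPhysics.QuantumFieldTheory.Balaban1983to89.TreeLength
open Literature.MathematicalPhysics.QuantumFieldTheory.Balaban1983to89.B16SProfile
open Literature.MathematicalPhysics.QuantumFieldTheory.Balaban1983to89.B16MergeGeometry
open Literature.MathematicalPhysics.QuantumFieldTheory.Balaban1983to89.B16Absorption
open Literature.MathematicalPhysics.QuantumFieldTheory.Balaban1983to89.B16StoppingRule
open Literature.MathematicalPhysics.QuantumFieldTheory.Balaban1983to89.B16MergeHorizon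
open Literature.MathematicalPhysics.QuantumFieldTheory.Balaban1983to89.B16Overhang
open Literature.MathematicalPhysics.QuantumFieldTheory.Balaban1983to89.B16OverhangN
open Summit.QuantumFields.BalabanUV.T4Continuum.HistoryRealise
open Summit.QuantumFields.BalabanUV.T4Continuum.HistoryRealiseCells
open Summit.QuantumFields.BalabanUV.T4Continuum.HistoryBankingAnchors
open Summit.QuantumFields.BalabanUV.T4Continuum.HistoryBankingFattenedVolume

namespace Summit.QuantumFields.BalabanUV.T4Continuum.HistoryBankingAnchors82

noncomputable section

variable {d : ℕ}

/-! ## §1 A dead piece from the `14`th step on: the radius-`82` box about the coarse image of ANY of its cubes -/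

/-- **b02's DEAD-PIECE BOX IN THE ONE-LAYER REGIME.**  If `S^{a}(B)` satisfies (i) then for every later step `a + t`
on the horizon with `t ≥ 14` and every cube `b ∈ B`, `S^{a+t}(B) ⊆ □(coarse_{Q_{a+t}} b, 82)`: the orbit box is ONE pbox
of side `width + 2·shrink + 1 ≤ 83` (`B16Overhang.side_le_83`) and contains the coarse image of `b`
(`closureIdx_Qprod_subset_Siter`) — b02's `Siter_subset_box_of_condI` with `side_le_281 ↦ side_le_83`. [folklore] -/
theorem Siter_subset_box82_of_condI {L : ℕ} (hL : 2 ≤ L) {σ : ℕ → ℕ} {m' : ℕ} (hσ : DropCtl σ m')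
    {B : Finset (Pt d)} {b : Pt d} (hb : b ∈ B) {a : ℕ} (hI : CondI 100 (Siter (ratio L σ) a B)) (t : ℕ)
    (h14 : 14 ≤ t) (ht : a + t ≤ m') :
    Siter (ratio L σ) (a + t) B ⊆ box (coarse (Qprod (ratio L σ) (a + t)) b) 82 := by
  have hq : ∀ l, 0 < ratio L σ l := fun l => ratio_pos (by omega) σ l
  obtain ⟨y, hy⟩ := Siter_nonempty (ratio L σ) ⟨b, hb⟩ a
  have hX := near_of_condI_touch hI hy (Touch.refl y)
  have hq' : ∀ l, 0 < ratio L (fun n => σ (a + n)) l := fun l => ratio_pos (by omega) _ l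
  have halt := altGain_ratio hL (B16MergeHorizon.dropCtl_shift hσ a)
  have hside := side_le_83 hq' halt (by norm_num : (0:ℤ) ≤ 100) (by norm_num) t h14 (by omega)
  have hside' : width (ratio L (fun n => σ (a + n))) t + 2 * shrink (ratio L (fun n => σ (a + n))) 100 t ≤ 82 := by
    have := Int.toNat_le.mp hside
    push_cast at this
    omega
  have hP : Siter (ratio L σ) (a + t) B ⊆
      pbox (fun i => envLo (ratio L (fun n => σ (a + n))) (y i) t - shrink (ratio L (fun n => σ (a + n))) 100 t)
           (fun i => env (ratio L (fun n => σ (a + n))) (y i) t + shrink (ratio L (fun n => σ (a + n))) 100 t) := by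
    rw [Siter_add, ratio_shift_fun]
    exact Siter_subset_pbox_of_near hq' hX t
  have hp : coarse (Qprod (ratio L σ) (a + t)) b ∈ Siter (ratio L σ) (a + t) B :=
    closureIdx_Qprod_subset_Siter _ _ _ (Finset.mem_image_of_mem _ hb)
  have hpP := mem_pbox.1 (hP hp)
  intro w hw
  have hwP := mem_pbox.1 (hP hw)
  rw [mem_box]
  intro i
  obtain ⟨h1, h2⟩ := hpP i
  obtain ⟨h3, h4⟩ := hwP i
  have hwid := env_sub_envLo_le_width hq' (y i) t
  push_cast
  constructor <;> omega

/-! ## §2 Orbit vocabulary: an OLD-dead orbit lies in the radius-`82` box about its anchor -/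

section Dead

variable {L : ℕ} {s : ℕ → ℕ}

/-- **AN OLD-DEAD ORBIT STAYS IN A RADIUS-`82` BOX**: along a flow with `L ≥ 2` and drop control on every horizon, if
the orbit of `Z` formed at `j` meets condition (i) at the relative index `a`, then at every index `l ≥ a + 14` it lies in
`box (coarse (Qfrom L s j l) c) 82` for every cube `c ∈ Z`. [folklore] -/
theorem orbit_subset_box82_of_condI (hL : 2 ≤ L) (hdrop : ∀ m, DropCtl s m) {j : ℕ} {Z : Finset (Pt d)} {c : Pt d}
    (hc : c ∈ Z) {a l : ℕ} (hI : CondI 100 (orbit L s j Z a)) (hal : a + 14 ≤ l) :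
    orbit L s j Z l ⊆ box (coarse (Qfrom L s j l) c) 82 := by
  have h := Siter_subset_box82_of_condI hL (dropCtl_from hdrop j l) hc (a := a) hI (l - a) (by omega) (by omega)
  rw [show a + (l - a) = l by omega] at h
  exact h

/-- hence an old-dead orbit has at most `165^d` cubes [folklore] -/
theorem card_orbit_le_165_of_condI (hL : 2 ≤ L) (hdrop : ∀ m, DropCtl s m) {j : ℕ} {Z : Finset (Pt d)} {c : Pt d}
    (hc : c ∈ Z) {a l : ℕ} (hI : CondI 100 (orbit L s j Z a)) (hal : a + 14 ≤ l) :
    (orbit L s j Z l).card ≤ 165 ^ d := by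
  have h := Finset.card_le_card (orbit_subset_box82_of_condI hL hdrop hc hI hal)
  rw [card_box] at h
  simpa using h

/-- the same in the birth-family vocabulary of A1: the old-dead orbit of a birth at time `m` lies in the radius-`82` box
about its anchor at scale `m`. [folklore] -/
theorem orbit_subset_box82_banchor {β : Type*} {jb : β → ℕ} {cb : β → Pt d} (hL : 2 ≤ L) (hdrop : ∀ m, DropCtl s m)
    {Zb : β → Finset (Pt d)} {b : β} (hc : cb b ∈ Zb b) {m a : ℕ} (hI : CondI 100 (orbit L s (jb b) (Zb b) a))
    (ham : a + 14 ≤ m - jb b) :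
    orbit L s (jb b) (Zb b) (m - jb b) ⊆ box (banchor L s jb cb b m) 82 :=
  orbit_subset_box82_of_condI hL hdrop hc hI ham

end Dead

/-! ## §3 The thickened footprint count -/

section Thick

variable {L : ℕ} {s : ℕ → ℕ}

/-- **THE COLLAR CONSTANT OF THE PER-LEVEL DEAD BOX**: `collar82 d = 165^d + (2^d − 1)·d·165^{d−1}` — one full radius-`82`
box plus one face slab for each of the further `2^d − 1` centres of a fully decayed footprint. [folklore] -/
def collar82 (d : ℕ) : ℝ := (165 : ℝ) ^ d + (2 ^ d - 1) * (d * 165 ^ (d - 1))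

/-- **THE FEEDBACK CONSTANT OF THE PER-LEVEL DEAD BOX**: `feed82 d = 2^d·16·21^d·d·165^{d−1}` — one face slab per
footprint cube of the decaying part `2^d·16·21^d·#Z∕2^i`. [folklore] -/
def feed82 (d : ℕ) : ℝ := 2 ^ d * (16 * 21 ^ d) * (d * 165 ^ (d - 1))

/-- the collar constant is at least `165^d` [folklore] -/
theorem pow_le_collar82 (d : ℕ) : (165 : ℝ) ^ d ≤ collar82 d := by
  unfold collar82
  have h1 : (1 : ℝ) ≤ 2 ^ d := one_le_pow₀ (by norm_num)
  have h2 : (0 : ℝ) ≤ d * 165 ^ (d - 1) := by positivity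
  nlinarith

/-- the collar constant is positive [folklore] -/
theorem collar82_pos (d : ℕ) : 0 < collar82 d := lt_of_lt_of_le (by positivity) (pow_le_collar82 d)

/-- the feedback constant is nonnegative [folklore] -/
theorem feed82_nonneg (d : ℕ) : 0 ≤ feed82 d := by unfold feed82; positivity

/-- **THE THICKENED FOOTPRINT COUNT, any radius.**  For a non-empty TOUCH-connected reference `Z` at time `t`, `L ≥ 4`,
drop control on every horizon and `i ≥ 1`, the `r`-thickening of the footprint `closureIdx (Qfrom L s t i) Z` has at most
`(2r+1)^d + (2^d − 1)·d·(2r+1)^{d−1} + 2^d·16·21^d·d·(2r+1)^{d−1}·#Z∕2^i` cubes: the footprint is touch-connected (b02's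
`touchConnected_closureIdx`) with `≤ 2^d·(16·21^d·#Z∕2^i + 1)` cubes (A1's decay), and the union of radius-`r` boxes about
a touch-connected set of `n` centres has `≤ (2r+1)^d + (n − 1)·d·(2r+1)^{d−1}` cubes (M5-1b (G1)). [folklore] -/
theorem card_thick_closureIdx_le (hL : 4 ≤ L) (hdrop : ∀ m, DropCtl s m) {Z : Finset (Pt d)} (hZ : Z.Nonempty)
    (hZc : TouchConnected Z) (t : ℕ) {i : ℕ} (hi : 1 ≤ i) (r : ℕ) :
    (((closureIdx (Qfrom L s t i) Z).biUnion fun p => box p r).card : ℝ) ≤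
      ((2 * r + 1 : ℝ) ^ d + (2 ^ d - 1) * (d * (2 * r + 1 : ℝ) ^ (d - 1)))
        + 2 ^ d * (16 * 21 ^ d) * (d * (2 * r + 1 : ℝ) ^ (d - 1)) * (Z.card : ℝ) / 2 ^ i := by
  set F := closureIdx (Qfrom L s t i) Z with hF
  have hFne : F.Nonempty := closureIdx_nonempty hZ
  have hFc : TouchConnected F := touchConnected_closureIdx (Qfrom_pos (by omega) s t i) hZc
  have h1 := card_biUnion_box_le_of_touchConnected_real hFc hFne r
  have h2 : (F.card : ℝ) ≤ 2 ^ d * (16 * (21 ^ d * (Z.card : ℝ)) / 2 ^ i + 1) :=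
    card_closureIdx_Qfrom_le_card hL hdrop hZ hZc t hi
  have hslab : (0 : ℝ) ≤ d * (2 * r + 1 : ℝ) ^ (d - 1) := by positivity
  have h3 : (F.card : ℝ) - 1 ≤ 2 ^ d * (16 * 21 ^ d) * (Z.card : ℝ) / 2 ^ i + (2 ^ d - 1) := by
    have : (2 : ℝ) ^ d * (16 * (21 ^ d * (Z.card : ℝ)) / 2 ^ i + 1)
        = 2 ^ d * (16 * 21 ^ d) * (Z.card : ℝ) / 2 ^ i + (2 ^ d - 1) + 1 := by ring
    linarith
  have h4 := mul_le_mul_of_nonneg_right h3 hslab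
  have h5 : (2 ^ d * (16 * 21 ^ d) * (Z.card : ℝ) / 2 ^ i + (2 ^ d - 1)) * (d * (2 * r + 1 : ℝ) ^ (d - 1))
      = (2 ^ d - 1) * (d * (2 * r + 1 : ℝ) ^ (d - 1))
        + 2 ^ d * (16 * 21 ^ d) * (d * (2 * r + 1 : ℝ) ^ (d - 1)) * (Z.card : ℝ) / 2 ^ i := by ring
  linarith

/-- **THE THICKENED FOOTPRINT COUNT AT RADIUS `82`**: `#(⋃_{p ∈ footprint} box p 82) ≤ collar82 d + feed82 d·#Z∕2^i`.
[folklore] -/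
theorem card_thick82_closureIdx_le (hL : 4 ≤ L) (hdrop : ∀ m, DropCtl s m) {Z : Finset (Pt d)} (hZ : Z.Nonempty)
    (hZc : TouchConnected Z) (t : ℕ) {i : ℕ} (hi : 1 ≤ i) :
    (((closureIdx (Qfrom L s t i) Z).biUnion fun p => box p 82).card : ℝ) ≤
      collar82 d + feed82 d * (Z.card : ℝ) / 2 ^ i := by
  have h := card_thick_closureIdx_le hL hdrop hZ hZc t hi 82
  unfold collar82 feed82
  norm_num at h ⊢
  exact h

/-- the union of radius-`82` boxes about ANY finite set of centres has at most `165^d` cubes per centre (the recent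
births' anchors, which lie outside the lag-time footprints). [folklore] -/
theorem card_biUnion_box82_le (A : Finset (Pt d)) : ((A.biUnion fun p => box p 82).card : ℝ) ≤ 165 ^ d * (A.card : ℝ) := by
  have h : (A.biUnion fun p => box p 82).card ≤ 165 ^ d * A.card := by
    refine Finset.card_biUnion_le.trans ?_
    rw [Finset.sum_const_nat (m := 165 ^ d) fun p _ => by norm_num [card_box], Nat.mul_comm]
  exact_mod_cast h

end Thick

/-! ## §4 Numerals at `d = 4` (census letters; the reading is the owner's, the certification balaban-calc's) -/

/-- `collar82 4 = 165⁴ + 15·4·165³ = 1 010 728 125`. [folklore] -/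
theorem collar82_four : collar82 4 = 1010728125 := by unfold collar82; norm_num

/-- `feed82 4 = 2⁴·16·21⁴·4·165³ = 894 600 153 216 000`. [folklore] -/
theorem feed82_four : feed82 4 = 894600153216000 := by unfold feed82; norm_num

/-- the floor exchange of the per-level dead box at `d = 4`: `6·collar82 4 = 6 064 368 750` (vs M5-2d's
`6·1122⁴ = 9 508 733 552 736`). [folklore] -/
theorem six_mul_collar82_four : 6 * collar82 4 = 6064368750 := by rw [collar82_four]; norm_num

end

end Summit.QuantumFields.BalabanUV.T4Continuum.HistoryBankingAnchors82
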